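import Mathlib
import HarnessLib
import Literature.MathematicalPhysics.QuantumLattice.SectorisedKernelNormPrescribedBridgeSwap
import Summits.HubbardSuperconductivity.HubbardSuperconductivity.Theorems.KLProgrammeKLRegimeEngineTowerLevBridge
import Summits.HubbardSuperconductivity.HubbardSuperconductivity.Theorems.KLProgrammeKLRegimeEngineTowerImportP2Plain

/-!
# Route `KLProgramme` — crux K3 ENGINE (stmt-HubbardSuperconductivity-20437 `KLRegimeEngineV17F2`), stub (b) v2, THE LEVELS PACKAGE (ℓ), located-risk #10
# «(ℓ)-LEV-ODD», cure (ε) design v2 §1 / §4 item 3: «(ℓ)-LEV-NSW» — THE SWAPPED LEVELLED-CURRENCY BRIDGE (the oriented line step's child datum)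
# (cell gate-hubbard-kl, seat hubbard-kl-k3c3-p2 g15)

The ORIENTED prescribed bracket (LEV-FLOOR-DESIGN-v2 §1–§2, BGM 2006 App. A4 (A4.8): per tree line the sector sum may be moved from the parent side to the
child side) reads a swapped line's CHILD with its root-ward slot pinned in POSITION ONLY (sector summed) and its further external slots sector-prescribed —
the one new abstract input hypothesis `hNsw` of the engine twin; in the doors' `(E, τ)`-filter currency this is the standard input sum
`ε^m Σ_{σ : σ|_E = τ|_E} Σ_{x : x_p = y} ‖W^{F}_σ(T)(x)‖` with the position pin `p` OUTSIDE the prescribed leg set `E`.  The companion `…TowerLevBridge`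
(k3c2-p3 g10) reads the STANDARD input (`p ∈ E`, `E.card = Fc + 1`) against the levelled carrier `klLevNormOf` at level `Fc` and the tower instance against
`klTowerMeasLev … Fc`.  Here: the kernels of the scale flow `𝒱_j[K]` are frequency– and momentum-conserving, hence their sectorised position kernels are
TRANSLATION INVARIANT in norm (`…EnginePlaneWaveConservation.norm_sectorisedKernel_translate`), hence the position fibre of ANY leg carries the same sum
(`Literature/…/SectorisedKernelNormPrescribedBridgeSwap.sum_filter_apply_eq_of_translate`) — so the `(E, τ)`-filter sum may be pinned at ANY leg, and the
swapped input with `E.card = Fc + 1` prescribed legs reads the SAME datum `klTowerMeasLev … Fc` as the standard input with `Fc` prescribed legs besides its pin: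
ONE LEVEL LOWER than a standard pin with the same prescribed set (design v2 §1: «level `|T|`, not `|T| + 1`»; no new data array).

* §1 translation rows for the tower carriers: `norm_sectorisedKernel_klTowerInput_translate`, `norm_sectorisedKernel_klTowerIncr_translate`
  (+ the `x_i + a` forms `…_translate'` matching the Literature lemma's `[AddGroup]` hypothesis);
* §2 `(E, τ)` currency: **`doorInputSw_le_klLevNormOf`** (conserving `T`, any pin leg `p`, `q ∈ E` names the level-`(E.card − 1)` prescription `τ on E ∖ {q}`),
  **`doorInputSw_of_levelBounds`** (`E.card = Fc + 1`, ANY pin leg ⇒ `≤ B Fc`), the tower instances **`doorInputSw_klTowerInput_le_klTowerMeasLev`**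
  (= `doorInput_klTowerInput_le_klTowerMeasLev` WITHOUT `q ∈ E`) and `doorInputSw_klTowerIncr_le_klTowerBornLev` (born increments re-read at `F_{dk}`);
* §3 supplier currency (the literal `hNsw` shape over `kernel (sectorPreimage β F_{dk−1} 𝒱_{dk}) (2m′+2)`):
  **`sum_norm_kernel_sectorPreimage_klTowerInput_posPinnedSlots_le`** — `Σ_{Y : (Y t).1 = y} ‖K Y‖·Π_{j : T}[(Y (ι j)).2 = s j] ≤ ε_x · klTowerMeasLev … d k (2(m′+1)) Fc`
  for `|T| = Fc + 1`, `ι` injective, ANY slot `t`; and the `Σ_{σ₀}`-over-the-pin's-sector form `sum_sum_norm_kernel_sectorPreimage_klTowerInput_prescribedSlots_le`.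
  **`exists_sectorProfile_kernel_sectorPreimage_klTowerInput`** (+ `…_klTowerIncr`) — the `∃ g` (sector-profile) shape = the literal `hKsw` of
  `KernelTreeDecayOriented.sum_restrictK_prod_lineProd_le_oriented` (k3c2-p3 g13) at the model vertex, with `N u (levR) := ε_x · klTowerMeasLev … Fc`.
  `exists_sectorProfile_kernel_sectorPreimage_klTowerInput_card` — the same-level crude companion (`|T| = Fc`, `Σ g ≤ |SectorLeg|·ε_x·klTowerMeasLev … Fc`) for the
  `hKsw` slot at vertices with no prescribed leg (BGM level `0`).
Proofs only (compositions of landed lemmas); nothing about the model is asserted; nothing asserts (ℓ), any stub, K3 or superconductivity.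
References: BGM 2006 §2.3 (2.17), §2.8 (2.76), (2.88)–(2.90), App. A4 (A4.5)–(A4.8) [cite: BenfattoGiulianiMastropietro2006].
-/

noncomputable section

namespace Summit.HubbardSuperconductivity.HubbardSuperconductivity.Theorems.EngineV8

set_option linter.dupNamespace false -- summit = problem name (single-conjunct summit), D-0017

open Classical
open Real Finset Literature.MathematicalPhysics.QuantumLattice Literature.Probability.LatticeModels GrassmannAlgebra
open Literature.MathematicalPhysics.QuantumLattice.FermiRG
open Summit.HubbardSuperconductivity.HubbardSuperconductivity.Theorems.KLRegimeSplit
open Summit.HubbardSuperconductivity.HubbardSuperconductivity.Theorems.KLProgrammeLegKernels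
open Summit.HubbardSuperconductivity.HubbardSuperconductivity.Theorems.DispersionFlow
open Summit.HubbardSuperconductivity.HubbardSuperconductivity.Theorems.KLRegimeWick

variable {L M : ℕ} [NeZero L] [NeZero M]

/-! ## §1 Translation rows for the tower carriers -/

/-- The sectorised kernels of the block input `𝒱_{dk}[K]` are translation invariant in norm (conservation of frequency and momentum). -/
theorem norm_sectorisedKernel_klTowerInput_translate {N : ℕ} {β : ℝ} (hβ : β ≠ 0) (F : Fin N → FreqMomentum L M → ℂ) (U μ : ℝ) (K : TrigPolyC4v)
    (d k m : ℕ) (Ω : Fin m → SectorLeg N) (x : Fin m → SpaceTimeIdx L M) (a : SpaceTimeIdx L M) :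
    ‖sectorisedKernel L M β F (klTowerInput L M β U μ K d k) m Ω (fun i => ((x i).1 + a.1, (x i).2 + a.2))‖ =
      ‖sectorisedKernel L M β F (klTowerInput L M β U μ K d k) m Ω x‖ :=
  norm_sectorisedKernel_klEffectiveAction_translate hβ F U μ K klE0 (d * k) m Ω x a

/-- The kernels of the block increment `Δ_k = 𝒱_{d(k+1)} − 𝒱_{dk}` vanish off the frequency-conservation surface (the momentum twin is
`…TowerRemeasureLev.klTowerIncr_momentumConserving`). -/
theorem kernel_klTowerIncr_eq_zero_of_freq (β U μ : ℝ) (K : TrigPolyC4v) (d k : ℕ) {m : ℕ} {X : Fin m → HubbardFieldIdx L M}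
    (hX : ∑ i, (if (X i).2 = 0 then (1 : ℤ) else -1) * matsubaraInt M (X i).1.1.1 ≠ 0) :
    kernel ℂ (klTowerIncr L M β U μ K d k) m X = 0 := by
  unfold klTowerIncr
  rw [sub_eq_add_neg, kernel_add, ← neg_one_smul ℂ (klEffectiveAction L M β U μ K klE0 (d * k)), kernel_smul,
    kernel_klEffectiveAction_eq_zero_of_freq β U μ K klE0 _ hX, kernel_klEffectiveAction_eq_zero_of_freq β U μ K klE0 _ hX, mul_zero, add_zero]

/-- The sectorised kernels of the block increment `Δ_k` are translation invariant in norm. -/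
theorem norm_sectorisedKernel_klTowerIncr_translate {N : ℕ} {β : ℝ} (hβ : β ≠ 0) (F : Fin N → FreqMomentum L M → ℂ) (U μ : ℝ) (K : TrigPolyC4v)
    (d k m : ℕ) (Ω : Fin m → SectorLeg N) (x : Fin m → SpaceTimeIdx L M) (a : SpaceTimeIdx L M) :
    ‖sectorisedKernel L M β F (klTowerIncr L M β U μ K d k) m Ω (fun i => ((x i).1 + a.1, (x i).2 + a.2))‖ =
      ‖sectorisedKernel L M β F (klTowerIncr L M β U μ K d k) m Ω x‖ :=
  norm_sectorisedKernel_translate hβ F _ (fun _ _ hX => kernel_klTowerIncr_eq_zero_of_freq β U μ K d k hX)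
    (fun m' X hX => klTowerIncr_momentumConserving β U μ K d k m' X hX) m Ω x a

/-! ## §2 `(E, τ)` currency: the doors' input sum pinned at ANY leg against the levelled carrier -/

/-- **THE SWAPPED DOOR INPUT IS DOMINATED BY THE LEVELLED CARRIER** (frequency– and momentum-conserving `T`, thin family `F_J`, `0 < β`): for ANY pin leg `p`
and any `q ∈ E`, `ε^m Σ_{σ : σ|_E = τ|_E} Σ_{x : x_p = y} ‖W^{F_J}_σ(T)(x)‖ ≤ klLevNormOf … J (m+1) T (τ on E ∖ {q})` — by translation invariance the position fibre of
leg `p` carries the same sum as that of leg `q`, where `doorInput_le_klLevNormOf` applies. -/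
theorem doorInputSw_le_klLevNormOf {β : ℝ} (hβ : 0 < β) (μ : ℝ) (K : TrigPolyC4v) (J : ℕ) (T : HubbardGrassmann L M)
    (hTf : ∀ (m : ℕ) (X : Fin m → HubbardFieldIdx L M),
      (∑ i, (if (X i).2 = 0 then (1 : ℤ) else -1) * matsubaraInt M (X i).1.1.1) ≠ 0 → kernel ℂ T m X = 0)
    (hT : ∀ (m : ℕ) (X : Fin m → HubbardFieldIdx L M), ∑ i, signedMomentum L (X i).2 (X i).1.1.2 ≠ 0 → kernel ℂ T m X = 0)
    {m : ℕ} (E : Finset (Fin (m + 1))) (τ : Fin (m + 1) → SectorLeg (sectorCount J)) {q : Fin (m + 1)} (hq : q ∈ E) (p : Fin (m + 1))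
    (y : SpaceTimeIdx L M) :
    imagTimeWeight β M ^ m *
        ∑ σ ∈ univ.filter (fun σ : Fin (m + 1) → SectorLeg (sectorCount J) => ∀ e ∈ E, σ e = τ e),
          ∑ x ∈ univ.filter (fun x : Fin (m + 1) → SpaceTimeIdx L M => x p = y),
            ‖sectorisedKernel L M β (klAnisoFamily L M β μ K klE0 J) T (m + 1) σ x‖ ≤
      klLevNormOf L M β μ K J (m + 1) T (fun i => if i ∈ E.erase q then some (τ i) else none) := by
  haveI : NeZero (2 * M) := ⟨by have := NeZero.ne M; omega⟩
  have htr : ∀ (σ : Fin (m + 1) → SectorLeg (sectorCount J)) (x : Fin (m + 1) → SpaceTimeIdx L M) (a : SpaceTimeIdx L M),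
      ‖sectorisedKernel L M β (klAnisoFamily L M β μ K klE0 J) T (m + 1) σ (fun i => x i + a)‖ =
        ‖sectorisedKernel L M β (klAnisoFamily L M β μ K klE0 J) T (m + 1) σ x‖ :=
    fun σ x a => norm_sectorisedKernel_translate hβ.ne' _ T hTf hT (m + 1) σ x a
  rw [sum_congr rfl fun σ _ => sum_filter_apply_eq_of_translate (fun x => ‖sectorisedKernel L M β (klAnisoFamily L M β μ K klE0 J) T (m + 1) σ x‖)
    (htr σ) p q y y]
  exact doorInput_le_klLevNormOf hβ.le μ K J T hT E τ hq y

/-- **THE SWAPPED DOORS' `hB` FROM LEVEL BOUNDS**: if every prescription of level `Fc` has `klLevNormOf … J (m+1) T Ωe′ ≤ B Fc`, then for every leg set `E` with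
`E.card = Fc + 1`, prescription `τ`, ANY pin leg `p` (in `E` or not) and point `y`: `ε^m Σ_{σ|_E = τ|_E} Σ_{x_p = y} ‖W^{F_J}_σ(T)(x)‖ ≤ B Fc` (conserving `T`, `0 < β`). -/
theorem doorInputSw_of_levelBounds {β : ℝ} (hβ : 0 < β) (μ : ℝ) (K : TrigPolyC4v) (J : ℕ) (T : HubbardGrassmann L M)
    (hTf : ∀ (m : ℕ) (X : Fin m → HubbardFieldIdx L M),
      (∑ i, (if (X i).2 = 0 then (1 : ℤ) else -1) * matsubaraInt M (X i).1.1.1) ≠ 0 → kernel ℂ T m X = 0)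
    (hT : ∀ (m : ℕ) (X : Fin m → HubbardFieldIdx L M), ∑ i, signedMomentum L (X i).2 (X i).1.1.2 ≠ 0 → kernel ℂ T m X = 0)
    {m : ℕ} (B : ℕ → ℝ)
    (hB : ∀ Ωe' : Fin (m + 1) → Option (SectorLeg (sectorCount J)), klLevNormOf L M β μ K J (m + 1) T Ωe' ≤ B (levelCount Ωe'))
    (Fc : ℕ) (E : Finset (Fin (m + 1))) (τ : Fin (m + 1) → SectorLeg (sectorCount J)) (p : Fin (m + 1)) (hE : E.card = Fc + 1)
    (y : SpaceTimeIdx L M) :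
    imagTimeWeight β M ^ m *
        ∑ σ ∈ univ.filter (fun σ : Fin (m + 1) → SectorLeg (sectorCount J) => ∀ e ∈ E, σ e = τ e),
          ∑ x ∈ univ.filter (fun x : Fin (m + 1) → SpaceTimeIdx L M => x p = y),
            ‖sectorisedKernel L M β (klAnisoFamily L M β μ K klE0 J) T (m + 1) σ x‖ ≤ B Fc := by
  have hne : E.Nonempty := by rw [← card_pos, hE]; exact Nat.succ_pos Fc
  obtain ⟨q, hq⟩ := hne
  refine (doorInputSw_le_klLevNormOf hβ μ K J T hTf hT E τ hq p y).trans ?_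
  have h := hB (fun i => if i ∈ E.erase q then some (τ i) else none)
  rwa [levelCount_prescribeOn_erase E τ hq, hE, Nat.add_sub_cancel] at h

/-- **TOWER INSTANCE: the swapped block step's `hB` for the input `𝒱_{dk}` at `F_{dk−1}` from the measured levelled sizes** — the literal shape of
`doorInput_klTowerInput_le_klTowerMeasLev` WITHOUT the condition `q ∈ E`: for every `E` with `E.card = Fc + 1`, every `τ`, ANY pin leg `q` and point `y`,
`ε_x^{2m′+1} Σ_{σ|_E = τ|_E} Σ_{x_q = y} ‖W^{F_{dk−1}}_σ(𝒱_{dk})(x)‖ ≤ klTowerMeasLev L M β U μ K d k (2(m′+1)) Fc` (`0 < β`).  Read as the oriented engine's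
swapped input: `Fc + 1` sector-prescribed slots, position-only pin ⇒ the measured datum at level-count `Fc` (one level below the standard pin's). -/
theorem doorInputSw_klTowerInput_le_klTowerMeasLev {β : ℝ} (hβ : 0 < β) (U μ : ℝ) (K : TrigPolyC4v) (d k : ℕ)
    (m' Fc : ℕ) (E : Finset (Fin (2 * m' + 1 + 1))) (τ : Fin (2 * m' + 1 + 1) → SectorLeg (sectorCount (d * k - 1)))
    (q : Fin (2 * m' + 1 + 1)) (hE : E.card = Fc + 1) (y : SpaceTimeIdx L M) :
    imagTimeWeight β M ^ (2 * m' + 1) *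
        ∑ σ ∈ univ.filter (fun σ : Fin (2 * m' + 1 + 1) → SectorLeg (sectorCount (d * k - 1)) => ∀ e ∈ E, σ e = τ e),
          ∑ x ∈ univ.filter (fun x : Fin (2 * m' + 1 + 1) → SpaceTimeIdx L M => x q = y),
            ‖sectorisedKernel L M β (klAnisoFamily L M β μ K klE0 (d * k - 1)) (klTowerInput L M β U μ K d k) (2 * m' + 1 + 1) σ x‖ ≤
      klTowerMeasLev L M β U μ K d k (2 * (m' + 1)) Fc := by
  have h2 : 2 * (m' + 1) = 2 * m' + 1 + 1 := by ring
  rw [h2]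
  refine doorInputSw_of_levelBounds hβ μ K (d * k - 1) (klTowerInput L M β U μ K d k)
    (fun m X hX => kernel_klEffectiveAction_eq_zero_of_freq β U μ K klE0 (d * k) hX)
    (fun m X hX => klEffectiveAction_momentumConserving β U μ K klE0 (d * k) m X hX)
    (fun Fc => klTowerMeasLev L M β U μ K d k (2 * m' + 1 + 1) Fc) (fun Ωe' => ?_) Fc E τ q hE y
  exact klLevNormOf_le_klTowerMeasLev β U μ K d k (2 * m' + 1 + 1) Ωe'

/-- The born twin: the swapped `(E, τ)`-filter sum of the block increment `Δ_k` at its born family `F_{dk}`, pinned at ANY leg, is at most the born levelled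
size `klTowerBornLev L M β U μ K d k (2(m′+1)) Fc` (`E.card = Fc + 1`, `0 < β`). -/
theorem doorInputSw_klTowerIncr_le_klTowerBornLev {β : ℝ} (hβ : 0 < β) (U μ : ℝ) (K : TrigPolyC4v) (d k : ℕ)
    (m' Fc : ℕ) (E : Finset (Fin (2 * m' + 1 + 1))) (τ : Fin (2 * m' + 1 + 1) → SectorLeg (sectorCount (d * k)))
    (q : Fin (2 * m' + 1 + 1)) (hE : E.card = Fc + 1) (y : SpaceTimeIdx L M) :
    imagTimeWeight β M ^ (2 * m' + 1) *
        ∑ σ ∈ univ.filter (fun σ : Fin (2 * m' + 1 + 1) → SectorLeg (sectorCount (d * k)) => ∀ e ∈ E, σ e = τ e),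
          ∑ x ∈ univ.filter (fun x : Fin (2 * m' + 1 + 1) → SpaceTimeIdx L M => x q = y),
            ‖sectorisedKernel L M β (klAnisoFamily L M β μ K klE0 (d * k)) (klTowerIncr L M β U μ K d k) (2 * m' + 1 + 1) σ x‖ ≤
      klTowerBornLev L M β U μ K d k (2 * (m' + 1)) Fc := by
  have h2 : 2 * (m' + 1) = 2 * m' + 1 + 1 := by ring
  rw [h2]
  refine doorInputSw_of_levelBounds hβ μ K (d * k) (klTowerIncr L M β U μ K d k)
    (fun m X hX => kernel_klTowerIncr_eq_zero_of_freq β U μ K d k hX)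
    (fun m X hX => klTowerIncr_momentumConserving β U μ K d k m X hX)
    (fun Fc => klTowerBornLev L M β U μ K d k (2 * m' + 1 + 1) Fc) (fun Ωe' => ?_) Fc E τ q hE y
  exact klLevNormOf_le_klTowerBornLev β U μ K d k (2 * m' + 1 + 1) Ωe'

/-! ## §3 Supplier currency: the oriented bracket's `hNsw` for the tower input -/

/-- **`hNsw` FOR THE TOWER INPUT** (the literal position-only-pin indicator shape of the oriented prescribed-leg supplier over
`K = kernel (sectorPreimage β F_{dk−1} 𝒱_{dk}[K]) (2m′+2)`): for every slot set `T` with `|T| = Fc + 1`, injective `ι`, prescribed labels `s`, ANY slot `t` and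
point `y`, `Σ_{Y : (Y t).1 = y} ‖K Y‖ · Π_{j : T} [ (Y (ι j)).2 = s j ] ≤ ε_x · klTowerMeasLev L M β U μ K d k (2(m′+1)) Fc` (`0 < β`) — the standard `hN` would read
`ε_x · klTowerMeasLev … |T|` at a FULL pin; the swapped child reads level-count `|T| − 1`. [cite: BenfattoGiulianiMastropietro2006, §2.8 (2.88)-(2.90), App. A4 (A4.8)] -/
theorem sum_norm_kernel_sectorPreimage_klTowerInput_posPinnedSlots_le {ι₀ : Type*} {β : ℝ} (hβ : 0 < β) (U μ : ℝ) (K : TrigPolyC4v)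
    (d k m' Fc : ℕ) (T : Finset ι₀) (hT : T.card = Fc + 1) (ι : T → Fin (2 * m' + 1 + 1)) (hι : Function.Injective ι)
    (t : Fin (2 * m' + 1 + 1)) (s : T → SectorLeg (sectorCount (d * k - 1))) (y : SpaceTimeIdx L M) :
    ∑ Y ∈ univ.filter (fun Y : Fin (2 * m' + 1 + 1) → SpaceTimeIdx L M × SectorLeg (sectorCount (d * k - 1)) => (Y t).1 = y),
        ‖kernel ℂ (sectorPreimage β (klAnisoFamily L M β μ K klE0 (d * k - 1)) (klTowerInput L M β U μ K d k)) (2 * m' + 1 + 1) Y‖ *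
          ∏ j : T, (if (Y (ι j)).2 = s j then (1 : ℝ) else 0) ≤
      imagTimeWeight β M * klTowerMeasLev L M β U μ K d k (2 * (m' + 1)) Fc :=
  sum_norm_kernel_sectorPreimage_posPinnedSlots_le_of_prescribedSum_le hβ.le _ _ (2 * m' + 1)
    (fun σ x a => norm_sectorisedKernel_klTowerInput_translate hβ.ne' _ U μ K d k _ σ x a)
    (fun E τ p hp hE y' => doorInput_klTowerInput_le_klTowerMeasLev hβ.le U μ K d k m' Fc E τ p hp hE y') T hT ι hι t s y

/-- The same with the pin's sector summed explicitly: `Σ_{σ₀} Σ_{Y : Y t = (y, σ₀)} ‖K Y‖ · Π_{j : T} [ … ] ≤ ε_x · klTowerMeasLev L M β U μ K d k (2(m′+1)) Fc`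
(the `Σ_σ`-of-full-pins shape of the swapped line step). -/
theorem sum_sum_norm_kernel_sectorPreimage_klTowerInput_prescribedSlots_le {ι₀ : Type*} {β : ℝ} (hβ : 0 < β) (U μ : ℝ) (K : TrigPolyC4v)
    (d k m' Fc : ℕ) (T : Finset ι₀) (hT : T.card = Fc + 1) (ι : T → Fin (2 * m' + 1 + 1)) (hι : Function.Injective ι)
    (t : Fin (2 * m' + 1 + 1)) (s : T → SectorLeg (sectorCount (d * k - 1))) (y : SpaceTimeIdx L M) :
    ∑ σ₀ : SectorLeg (sectorCount (d * k - 1)),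
      ∑ Y ∈ univ.filter (fun Y : Fin (2 * m' + 1 + 1) → SpaceTimeIdx L M × SectorLeg (sectorCount (d * k - 1)) => Y t = (y, σ₀)),
        ‖kernel ℂ (sectorPreimage β (klAnisoFamily L M β μ K klE0 (d * k - 1)) (klTowerInput L M β U μ K d k)) (2 * m' + 1 + 1) Y‖ *
          ∏ j : T, (if (Y (ι j)).2 = s j then (1 : ℝ) else 0) ≤
      imagTimeWeight β M * klTowerMeasLev L M β U μ K d k (2 * (m' + 1)) Fc := by
  rw [sum_sum_prescribedSlots_eq_posPinnedSlots]
  exact sum_norm_kernel_sectorPreimage_klTowerInput_posPinnedSlots_le hβ U μ K d k m' Fc T hT ι hι t s y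

/-- **`hKsw` FOR THE TOWER INPUT, `∃ g` (sector-profile) shape** — the literal child-side hypothesis of the oriented tree-decay lemma
(`Literature/Probability/LatticeModels/KernelTreeDecayOriented`, k3c2-p3): for `K = kernel (sectorPreimage β F_{dk−1} 𝒱_{dk}[K]) (2m′+2)`, every slot set `T` with
`|T| = Fc + 1`, injective `ι`, labels `s` and ANY slot `t` there is `g ≥ 0` on the sector labels with `Σ_{Y : Y t = a} ‖K Y‖ · Π_{j : T} [ (Y (ι j)).2 = s j ] ≤ g a.2`
for EVERY full label `a` and `Σ_{σ₀} g σ₀ ≤ ε_x · klTowerMeasLev L M β U μ K d k (2(m′+1)) Fc` (`0 < β`). [cite: BenfattoGiulianiMastropietro2006, §2.8 (2.88)-(2.90), App. A4 (A4.8)] -/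
theorem exists_sectorProfile_kernel_sectorPreimage_klTowerInput {ι₀ : Type*} {β : ℝ} (hβ : 0 < β) (U μ : ℝ) (K : TrigPolyC4v)
    (d k m' Fc : ℕ) (T : Finset ι₀) (hT : T.card = Fc + 1) (ι : T → Fin (2 * m' + 1 + 1)) (hι : Function.Injective ι)
    (t : Fin (2 * m' + 1 + 1)) (s : T → SectorLeg (sectorCount (d * k - 1))) :
    ∃ g : SectorLeg (sectorCount (d * k - 1)) → ℝ, (∀ σ₀, 0 ≤ g σ₀) ∧
      (∀ a : SpaceTimeIdx L M × SectorLeg (sectorCount (d * k - 1)),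
        ∑ Y ∈ univ.filter (fun Y : Fin (2 * m' + 1 + 1) → SpaceTimeIdx L M × SectorLeg (sectorCount (d * k - 1)) => Y t = a),
          ‖kernel ℂ (sectorPreimage β (klAnisoFamily L M β μ K klE0 (d * k - 1)) (klTowerInput L M β U μ K d k)) (2 * m' + 1 + 1) Y‖ *
            ∏ j : T, (if (Y (ι j)).2 = s j then (1 : ℝ) else 0) ≤ g a.2) ∧
      ∑ σ₀, g σ₀ ≤ imagTimeWeight β M * klTowerMeasLev L M β U μ K d k (2 * (m' + 1)) Fc :=
  exists_sectorProfile_kernel_sectorPreimage_of_prescribedSum_le hβ.le _ _ (2 * m' + 1)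
    (fun σ x a => norm_sectorisedKernel_klTowerInput_translate hβ.ne' _ U μ K d k _ σ x a)
    (fun E τ p hp hE y' => doorInput_klTowerInput_le_klTowerMeasLev hβ.le U μ K d k m' Fc E τ p hp hE y') T hT ι hι t s

/-- The born twin of the `∃ g` shape for the block increment `Δ_k` at `F_{dk}` (re-read as an input one block later it is re-measured; this row serves a
same-block reading): `Σ_{σ₀} g σ₀ ≤ ε_x · klTowerBornLev L M β U μ K d k (2(m′+1)) Fc`. [cite: BenfattoGiulianiMastropietro2006, §2.8 (2.88)-(2.90), App. A4 (A4.8)] -/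
theorem exists_sectorProfile_kernel_sectorPreimage_klTowerIncr {ι₀ : Type*} {β : ℝ} (hβ : 0 < β) (U μ : ℝ) (K : TrigPolyC4v)
    (d k m' Fc : ℕ) (T : Finset ι₀) (hT : T.card = Fc + 1) (ι : T → Fin (2 * m' + 1 + 1)) (hι : Function.Injective ι)
    (t : Fin (2 * m' + 1 + 1)) (s : T → SectorLeg (sectorCount (d * k))) :
    ∃ g : SectorLeg (sectorCount (d * k)) → ℝ, (∀ σ₀, 0 ≤ g σ₀) ∧
      (∀ a : SpaceTimeIdx L M × SectorLeg (sectorCount (d * k)),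
        ∑ Y ∈ univ.filter (fun Y : Fin (2 * m' + 1 + 1) → SpaceTimeIdx L M × SectorLeg (sectorCount (d * k)) => Y t = a),
          ‖kernel ℂ (sectorPreimage β (klAnisoFamily L M β μ K klE0 (d * k)) (klTowerIncr L M β U μ K d k)) (2 * m' + 1 + 1) Y‖ *
            ∏ j : T, (if (Y (ι j)).2 = s j then (1 : ℝ) else 0) ≤ g a.2) ∧
      ∑ σ₀, g σ₀ ≤ imagTimeWeight β M * klTowerBornLev L M β U μ K d k (2 * (m' + 1)) Fc := by
  have h2 : 2 * (m' + 1) = 2 * m' + 1 + 1 := by ring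
  rw [h2]
  refine exists_sectorProfile_kernel_sectorPreimage_of_prescribedSum_le hβ.le _ _ (2 * m' + 1)
    (fun σ x a => norm_sectorisedKernel_klTowerIncr_translate hβ.ne' _ U μ K d k _ σ x a) (fun E τ p hp hE y' => ?_) T hT ι hι t s
  refine doorInput_of_levelBounds hβ.le μ K (d * k) (klTowerIncr L M β U μ K d k)
    (fun m X hX => klTowerIncr_momentumConserving β U μ K d k m X hX)
    (fun Fc => klTowerBornLev L M β U μ K d k (2 * m' + 1 + 1) Fc) (fun Ωe' => ?_) Fc E τ p hp hE y'
  exact klLevNormOf_le_klTowerBornLev β U μ K d k (2 * m' + 1 + 1) Ωe'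

/-- **`hKsw` FOR THE TOWER INPUT AT THE SAME LEVEL, CRUDE COUNT** (the `∃ g` slot of the oriented tree-decay lemma at a vertex with no prescribed slot
left to re-pin at, e.g. BGM level `0`): for `|T| = Fc`, `ι` injective MISSING `t`, there is `g ≥ 0` with the full-pin sums `≤ g a.2` and
`Σ_{σ₀} g σ₀ ≤ |SectorLeg (sectorCount (dk−1))| · (ε_x · klTowerMeasLev L M β U μ K d k (2(m′+1)) Fc)` (`0 < β`). [cite: BenfattoGiulianiMastropietro2006, §2.8 (2.88)-(2.90), App. A4 (A4.8)] -/
theorem exists_sectorProfile_kernel_sectorPreimage_klTowerInput_card {ι₀ : Type*} {β : ℝ} (hβ : 0 < β) (U μ : ℝ) (K : TrigPolyC4v)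
    (d k m' Fc : ℕ) (T : Finset ι₀) (hT : T.card = Fc) (ι : T → Fin (2 * m' + 1 + 1)) (hι : Function.Injective ι)
    (t : Fin (2 * m' + 1 + 1)) (ht : ∀ j : T, ι j ≠ t) (s : T → SectorLeg (sectorCount (d * k - 1))) :
    ∃ g : SectorLeg (sectorCount (d * k - 1)) → ℝ, (∀ σ₀, 0 ≤ g σ₀) ∧
      (∀ a : SpaceTimeIdx L M × SectorLeg (sectorCount (d * k - 1)),
        ∑ Y ∈ univ.filter (fun Y : Fin (2 * m' + 1 + 1) → SpaceTimeIdx L M × SectorLeg (sectorCount (d * k - 1)) => Y t = a),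
          ‖kernel ℂ (sectorPreimage β (klAnisoFamily L M β μ K klE0 (d * k - 1)) (klTowerInput L M β U μ K d k)) (2 * m' + 1 + 1) Y‖ *
            ∏ j : T, (if (Y (ι j)).2 = s j then (1 : ℝ) else 0) ≤ g a.2) ∧
      ∑ σ₀, g σ₀ ≤ Fintype.card (SectorLeg (sectorCount (d * k - 1))) * (imagTimeWeight β M * klTowerMeasLev L M β U μ K d k (2 * (m' + 1)) Fc) :=
  exists_sectorProfile_kernel_sectorPreimage_of_prescribedSum_le_card hβ.le _ _ (2 * m' + 1)
    (fun σ x a => norm_sectorisedKernel_klTowerInput_translate hβ.ne' _ U μ K d k _ σ x a)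
    (fun E τ p hp hE y' => doorInput_klTowerInput_le_klTowerMeasLev hβ.le U μ K d k m' Fc E τ p hp hE y') T hT ι hι t ht s

end Summit.HubbardSuperconductivity.HubbardSuperconductivity.Theorems.EngineV8
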